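import Summits.QuantumFields.YangMills.Theorems.BalabanUVNodesN19DiscreteJackson

/-!
# YM-DAG node N19 (= NE7 proper) — THE DISCRETE TENSOR JACKSON QUASI-INTERPOLANT, II: the weights `W_a` and the tensor approximation at rate `m⁻¹`

Cell `pub-ymgap`, HUMAN RULING D-0062 (Track A), R141 (C) wider-strategy seat `pub-ymgap-dag-n19-e` (strategy s3 = ALTERNATIVE CURRENCY), generation
g20, module 2 (lineage module 60).  Route `Summits/QuantumFields/YangMills/Theses/BalabanUVNodes.lean` rev 25, cluster item K3⁷ «SpineGivenEndpointR13SepCoPH»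
(stmt-QuantumFields-20544, dag-lead WORDS-143); filed `--supports` that item `--as helper` (it proves no registered stub).  COUNT-NEUTRAL: [folklore] real
analysis over Mathlib (`Fintype.prod_sum`, `Fintype.prod_ite_eq'`, `Real.cos_arccos`) + the sibling p-module 59 `…N19DiscreteJackson` BY NAME
(`sum_fejerSq_node_eq`, `sum_fejerSq_mul_abs_cos_sub_le`); Mathlib-generic, no scheme object; NOT a discharge claim.

THE RESULT.  With the Fejér sum `F_m(u) = Σ_{j₁,j₂<m} cos((j₁−j₂)u)`, `c_m = m(2m²+1)∕3`, nodes `θ_a = 2πa∕N` (`a < N`, `2m ≤ N`) and the symmetrised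
JACKSON WEIGHTS `W_a(t) = (F_m(t − θ_a)² + F_m(t + θ_a)²)∕(2N c_m)` (displayed, never named; the `+θ_a` half is the `−θ_a` half at `−t`, `F_m` being even):
`W_a ≥ 0`, `Σ_a W_a(t) = 1` (module 59's mass identity), `Σ_a W_a(t)·|cos t − cos θ_a| ≤ π∕m` (module 59's first moment); for the TENSOR weights
`∏_i W_{a_i}(t_i)` (`a : ι → [N]`) the same with the other coordinates summing out (`Fintype.prod_sum`, as module 55's tensor Bernstein), whence
★ `abs_tensorJackson_sub_le`: for `g : (ι → ℝ) → ℝ` with `|g u − g v| ≤ K Σ_i|u_i − v_i|` on `[−1,1]^ι` and every `t : ι → ℝ`,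
  `|Σ_{a : ι → [N]} g((cos θ_{a_i})_i)·∏_i W_{a_i}(t_i) − g((cos t_i)_i)| ≤ πK|ι|∕m`,
and ★ `abs_tensorJackson_sub_le_cube` (at `t = arccos ∘ x`, `x ∈ [−1,1]^ι`) — the DISCRETE TENSOR JACKSON QUASI-INTERPOLANT approximates at RATE `m⁻¹`
(vs the tensor Bernstein operator's `n^{−1∕2}`, module 55), sampling `g` at the `N^{|ι|}` Chebyshev-type nodes `(cos θ_{a_i})_i` only.  The pricing sibling
(module 61) identifies `∏_i W_{a_i}(arccos x_i)` with a product of univariate polynomials of degree `≤ 2m − 2` and prices it at the mixed moments.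

HONEST FRAMING (binding).  [folklore] (D. Jackson 1911; discrete de la Vallée-Poussin ∕ Jackson quasi-interpolants); Mathlib-generic; NO consumer in the
DAG today (it sharpens the lineage's own joint-law rate); nothing of Bałaban's instantiated; NE7 NOT PRINTED, NOT proved; N19 NOT discharged; count-neutral.
One finite `T⁴` programme at fixed `ε`; nothing continuum ∕ `ℝ⁴` ∕ OS ∕ mass-gap ∕ Clay.  0 `def` ∕ 0 `sorry`.
-/

noncomputable section

open Real Finset

namespace Summit.QuantumFields.YangMills.Theorems.BalabanUVNodesN19DiscreteJacksonTensor

open Summit.QuantumFields.YangMills.Theorems.BalabanUVNodesN19DiscreteJackson (sum_fejerSq_node_eq sum_fejerSq_mul_abs_cos_sub_le)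

/-! ## §1 The symmetrised Jackson weights `W_a(t) = (F_m(t − θ_a)² + F_m(t + θ_a)²)∕(2N c_m)` and the tensor approximation theorem [folklore] -/

/-- The Fejér sum is even. [folklore] -/
theorem fejerSum_neg (m : ℕ) (u : ℝ) :
    ∑ j₁ ∈ range m, ∑ j₂ ∈ range m, Real.cos (((j₁ : ℝ) - j₂) * (-u)) =
      ∑ j₁ ∈ range m, ∑ j₂ ∈ range m, Real.cos (((j₁ : ℝ) - j₂) * u) := by
  refine Finset.sum_congr rfl fun j₁ _ => Finset.sum_congr rfl fun j₂ _ => ?_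
  rw [mul_neg, Real.cos_neg]

/-- The `+θ_a` node sums are the `−θ_a` node sums at `−t`. [bookkeeping] -/
theorem fejerSum_add_node_eq (m : ℕ) (t θ : ℝ) :
    ∑ j₁ ∈ range m, ∑ j₂ ∈ range m, Real.cos (((j₁ : ℝ) - j₂) * (t + θ)) =
      ∑ j₁ ∈ range m, ∑ j₂ ∈ range m, Real.cos (((j₁ : ℝ) - j₂) * (-t - θ)) := by
  rw [← fejerSum_neg m (t + θ), neg_add']

/-- `W_a(t) ≥ 0`. [folklore] -/
theorem jacksonWeight_nonneg (m N a : ℕ) (t : ℝ) :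
    0 ≤ ((∑ j₁ ∈ range m, ∑ j₂ ∈ range m, Real.cos (((j₁ : ℝ) - j₂) * (t - 2 * π * a / N))) ^ 2 +
          (∑ j₁ ∈ range m, ∑ j₂ ∈ range m, Real.cos (((j₁ : ℝ) - j₂) * (t + 2 * π * a / N))) ^ 2) /
        (2 * N * (m * (2 * m ^ 2 + 1) / 3)) := by
  positivity

/-- **`Σ_{a<N} W_a(t) = 1`** (`2m ≤ N`, `m ≥ 1`). [folklore] -/
theorem sum_jacksonWeight_eq_one {m N : ℕ} (hm : 0 < m) (hN : 2 * m ≤ N) (t : ℝ) :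
    ∑ a ∈ range N, ((∑ j₁ ∈ range m, ∑ j₂ ∈ range m, Real.cos (((j₁ : ℝ) - j₂) * (t - 2 * π * a / N))) ^ 2 +
          (∑ j₁ ∈ range m, ∑ j₂ ∈ range m, Real.cos (((j₁ : ℝ) - j₂) * (t + 2 * π * a / N))) ^ 2) /
        (2 * N * (m * (2 * m ^ 2 + 1) / 3)) = 1 := by
  have hmr : (0 : ℝ) < m := Nat.cast_pos.2 hm
  have hNr : (0 : ℝ) < N := Nat.cast_pos.2 (by omega)
  rw [← Finset.sum_div, Finset.sum_add_distrib, sum_fejerSq_node_eq hm hN t]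
  simp_rw [fejerSum_add_node_eq]
  rw [sum_fejerSq_node_eq hm hN (-t), div_eq_one_iff_eq (by positivity)]
  ring

/-- **`Σ_{a<N} W_a(t)·|cos t − cos θ_a| ≤ π∕m`** (`2m ≤ N`, `m ≥ 1`). [folklore] -/
theorem sum_jacksonWeight_mul_abs_cos_sub_le {m N : ℕ} (hm : 0 < m) (hN : 2 * m ≤ N) (t : ℝ) :
    ∑ a ∈ range N, ((∑ j₁ ∈ range m, ∑ j₂ ∈ range m, Real.cos (((j₁ : ℝ) - j₂) * (t - 2 * π * a / N))) ^ 2 +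
          (∑ j₁ ∈ range m, ∑ j₂ ∈ range m, Real.cos (((j₁ : ℝ) - j₂) * (t + 2 * π * a / N))) ^ 2) /
        (2 * N * (m * (2 * m ^ 2 + 1) / 3)) * |Real.cos t - Real.cos (2 * π * a / N)| ≤ π / m := by
  have hmr : (0 : ℝ) < m := Nat.cast_pos.2 hm
  have hNr : (0 : ℝ) < N := Nat.cast_pos.2 (by omega)
  have hc : (0 : ℝ) < 2 * N * (m * (2 * m ^ 2 + 1) / 3) := by positivity
  have h1 := sum_fejerSq_mul_abs_cos_sub_le hm hN t
  have h2 := sum_fejerSq_mul_abs_cos_sub_le hm hN (-t)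
  rw [Real.cos_neg] at h2
  simp_rw [div_mul_eq_mul_div, ← Finset.sum_div, add_mul, Finset.sum_add_distrib, fejerSum_add_node_eq]
  rw [div_le_div_iff₀ hc hmr]
  calc (∑ a ∈ range N, (∑ j₁ ∈ range m, ∑ j₂ ∈ range m, Real.cos (((j₁ : ℝ) - j₂) * (t - 2 * π * a / N))) ^ 2 *
            |Real.cos t - Real.cos (2 * π * a / N)| +
          ∑ a ∈ range N, (∑ j₁ ∈ range m, ∑ j₂ ∈ range m, Real.cos (((j₁ : ℝ) - j₂) * (-t - 2 * π * a / N))) ^ 2 *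
            |Real.cos t - Real.cos (2 * π * a / N)|) * m
      ≤ (π * N * (m * (2 * m ^ 2 + 1) / 3) / m + π * N * (m * (2 * m ^ 2 + 1) / 3) / m) * m :=
        mul_le_mul_of_nonneg_right (add_le_add h1 h2) hmr.le
    _ = π * (2 * N * (m * (2 * m ^ 2 + 1) / 3)) := by
        field_simp
        ring

variable {ι : Type*} [Fintype ι] [DecidableEq ι]

/-- The tensor Jackson weights `∏_i W_{a_i}(t_i)`, `a : ι → [N]`, sum to `1`. [folklore] -/
theorem sum_prod_jacksonWeight_eq_one {m N : ℕ} (hm : 0 < m) (hN : 2 * m ≤ N) (t : ι → ℝ) :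
    ∑ a : ι → Fin N, ∏ i,
      ((∑ j₁ ∈ range m, ∑ j₂ ∈ range m, Real.cos (((j₁ : ℝ) - j₂) * (t i - 2 * π * (a i : ℕ) / N))) ^ 2 +
          (∑ j₁ ∈ range m, ∑ j₂ ∈ range m, Real.cos (((j₁ : ℝ) - j₂) * (t i + 2 * π * (a i : ℕ) / N))) ^ 2) /
        (2 * N * (m * (2 * m ^ 2 + 1) / 3)) = 1 := by
  rw [← Fintype.prod_sum (fun i (b : Fin N) =>
    ((∑ j₁ ∈ range m, ∑ j₂ ∈ range m, Real.cos (((j₁ : ℝ) - j₂) * (t i - 2 * π * (b : ℕ) / N))) ^ 2 +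
          (∑ j₁ ∈ range m, ∑ j₂ ∈ range m, Real.cos (((j₁ : ℝ) - j₂) * (t i + 2 * π * (b : ℕ) / N))) ^ 2) /
        (2 * N * (m * (2 * m ^ 2 + 1) / 3)))]
  refine Finset.prod_eq_one fun i _ => ?_
  rw [Fin.sum_univ_eq_sum_range (fun b : ℕ =>
    ((∑ j₁ ∈ range m, ∑ j₂ ∈ range m, Real.cos (((j₁ : ℝ) - j₂) * (t i - 2 * π * b / N))) ^ 2 +
          (∑ j₁ ∈ range m, ∑ j₂ ∈ range m, Real.cos (((j₁ : ℝ) - j₂) * (t i + 2 * π * b / N))) ^ 2) /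
        (2 * N * (m * (2 * m ^ 2 + 1) / 3))) N]
  exact sum_jacksonWeight_eq_one hm hN (t i)

omit [DecidableEq ι] in
/-- The tensor Jackson weights are non-negative. [folklore] -/
theorem prod_jacksonWeight_nonneg (m N : ℕ) (t : ι → ℝ) (a : ι → Fin N) :
    0 ≤ ∏ i,
      ((∑ j₁ ∈ range m, ∑ j₂ ∈ range m, Real.cos (((j₁ : ℝ) - j₂) * (t i - 2 * π * (a i : ℕ) / N))) ^ 2 +
          (∑ j₁ ∈ range m, ∑ j₂ ∈ range m, Real.cos (((j₁ : ℝ) - j₂) * (t i + 2 * π * (a i : ℕ) / N))) ^ 2) /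
        (2 * N * (m * (2 * m ^ 2 + 1) / 3)) :=
  Finset.prod_nonneg fun i _ => jacksonWeight_nonneg m N (a i) (t i)

/-- One coordinate's first absolute moment against the tensor weights: `Σ_a |cos t_i − cos θ_{a_i}|·∏_j W_{a_j}(t_j) ≤ π∕m` — the other coordinates
sum out (`Fintype.prod_sum`), coordinate `i` is `sum_jacksonWeight_mul_abs_cos_sub_le`. [folklore] -/
theorem sum_abs_sub_mul_prod_jacksonWeight_le {m N : ℕ} (hm : 0 < m) (hN : 2 * m ≤ N) (t : ι → ℝ) (i : ι) :
    ∑ a : ι → Fin N, |Real.cos (t i) - Real.cos (2 * π * (a i : ℕ) / N)| * ∏ j,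
      ((∑ j₁ ∈ range m, ∑ j₂ ∈ range m, Real.cos (((j₁ : ℝ) - j₂) * (t j - 2 * π * (a j : ℕ) / N))) ^ 2 +
          (∑ j₁ ∈ range m, ∑ j₂ ∈ range m, Real.cos (((j₁ : ℝ) - j₂) * (t j + 2 * π * (a j : ℕ) / N))) ^ 2) /
        (2 * N * (m * (2 * m ^ 2 + 1) / 3)) ≤ π / m := by
  -- abbreviate the univariate weight
  set W : ι → ℕ → ℝ := fun j b =>
    ((∑ j₁ ∈ range m, ∑ j₂ ∈ range m, Real.cos (((j₁ : ℝ) - j₂) * (t j - 2 * π * b / N))) ^ 2 +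
          (∑ j₁ ∈ range m, ∑ j₂ ∈ range m, Real.cos (((j₁ : ℝ) - j₂) * (t j + 2 * π * b / N))) ^ 2) /
        (2 * N * (m * (2 * m ^ 2 + 1) / 3)) with hWdef
  show ∑ a : ι → Fin N, |Real.cos (t i) - Real.cos (2 * π * (a i : ℕ) / N)| * ∏ j, W j (a j) ≤ π / m
  have hw : ∀ a : ι → Fin N, |Real.cos (t i) - Real.cos (2 * π * (a i : ℕ) / N)| * ∏ j, W j (a j) =
      ∏ j, ((if j = i then |Real.cos (t j) - Real.cos (2 * π * (a j : ℕ) / N)| else 1) * W j (a j)) := fun a => by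
    rw [Finset.prod_mul_distrib, Fintype.prod_ite_eq']
  rw [Finset.sum_congr rfl fun a _ => hw a,
    ← Fintype.prod_sum (fun j (b : Fin N) => (if j = i then |Real.cos (t j) - Real.cos (2 * π * (b : ℕ) / N)| else 1) * W j b)]
  have hj : ∀ j, ∑ b : Fin N, (if j = i then |Real.cos (t j) - Real.cos (2 * π * (b : ℕ) / N)| else 1) * W j b =
      if j = i then ∑ b : Fin N, |Real.cos (t i) - Real.cos (2 * π * (b : ℕ) / N)| * W i b else 1 := fun j => by
    split_ifs with h
    · subst h; rfl
    · simp only [one_mul]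
      rw [Fin.sum_univ_eq_sum_range (fun b => W j b) N]
      exact sum_jacksonWeight_eq_one hm hN (t j)
  rw [Finset.prod_congr rfl fun j _ => hj j, Fintype.prod_ite_eq' i
    (fun _ => ∑ b : Fin N, |Real.cos (t i) - Real.cos (2 * π * (b : ℕ) / N)| * W i b),
    Fin.sum_univ_eq_sum_range (fun b => |Real.cos (t i) - Real.cos (2 * π * b / N)| * W i b) N]
  simp_rw [hWdef, mul_comm |Real.cos (t i) - _| _]
  exact sum_jacksonWeight_mul_abs_cos_sub_le hm hN (t i)

/-- ★ **DISCRETE TENSOR JACKSON APPROXIMATION — RATE `m⁻¹`** [folklore]: for `g : (ι → ℝ) → ℝ` with `|g u − g v| ≤ K·Σ_i |u_i − v_i|` on the cube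
`[−1,1]^ι` (`0 ≤ K`), `m ≥ 1`, `2m ≤ N`, at every `t : ι → ℝ`:
`|Σ_{a : ι → [N]} g((cos(2πa_i∕N))_i)·∏_i W_{a_i}(t_i) − g((cos t_i)_i)| ≤ K·π·|ι|∕m`. -/
theorem abs_tensorJackson_sub_le {g : (ι → ℝ) → ℝ} {K : ℝ} (hK0 : 0 ≤ K)
    (hK : ∀ u v : ι → ℝ, (∀ i, u i ∈ Set.Icc (-1 : ℝ) 1) → (∀ i, v i ∈ Set.Icc (-1 : ℝ) 1) → |g u - g v| ≤ K * ∑ i, |u i - v i|)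
    {m N : ℕ} (hm : 0 < m) (hN : 2 * m ≤ N) (t : ι → ℝ) :
    |∑ a : ι → Fin N, g (fun i => Real.cos (2 * π * (a i : ℕ) / N)) * ∏ i,
        ((∑ j₁ ∈ range m, ∑ j₂ ∈ range m, Real.cos (((j₁ : ℝ) - j₂) * (t i - 2 * π * (a i : ℕ) / N))) ^ 2 +
            (∑ j₁ ∈ range m, ∑ j₂ ∈ range m, Real.cos (((j₁ : ℝ) - j₂) * (t i + 2 * π * (a i : ℕ) / N))) ^ 2) /
          (2 * N * (m * (2 * m ^ 2 + 1) / 3)) -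
      g (fun i => Real.cos (t i))| ≤ K * (π * Fintype.card ι / m) := by
  set W : ι → ℕ → ℝ := fun j b =>
    ((∑ j₁ ∈ range m, ∑ j₂ ∈ range m, Real.cos (((j₁ : ℝ) - j₂) * (t j - 2 * π * b / N))) ^ 2 +
          (∑ j₁ ∈ range m, ∑ j₂ ∈ range m, Real.cos (((j₁ : ℝ) - j₂) * (t j + 2 * π * b / N))) ^ 2) /
        (2 * N * (m * (2 * m ^ 2 + 1) / 3)) with hWdef
  show |∑ a : ι → Fin N, g (fun i => Real.cos (2 * π * (a i : ℕ) / N)) * ∏ i, W i (a i) - g (fun i => Real.cos (t i))| ≤ _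
  have hnode : ∀ a : ι → Fin N, ∀ i, Real.cos (2 * π * (a i : ℕ) / N) ∈ Set.Icc (-1 : ℝ) 1 := fun a i =>
    ⟨Real.neg_one_le_cos _, Real.cos_le_one _⟩
  have hy : ∀ i, Real.cos (t i) ∈ Set.Icc (-1 : ℝ) 1 := fun i => ⟨Real.neg_one_le_cos _, Real.cos_le_one _⟩
  have hone : ∑ a : ι → Fin N, ∏ i, W i (a i) = 1 := sum_prod_jacksonWeight_eq_one hm hN t
  have hnn : ∀ a : ι → Fin N, 0 ≤ ∏ i, W i (a i) := fun a => prod_jacksonWeight_nonneg m N t a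
  have hrepr : g (fun i => Real.cos (t i)) = ∑ a : ι → Fin N, g (fun i => Real.cos (t i)) * ∏ i, W i (a i) := by
    rw [← Finset.mul_sum, hone, mul_one]
  rw [hrepr, ← Finset.sum_sub_distrib]
  calc |∑ a : ι → Fin N, (g (fun i => Real.cos (2 * π * (a i : ℕ) / N)) * ∏ i, W i (a i) -
          g (fun i => Real.cos (t i)) * ∏ i, W i (a i))|
      ≤ ∑ a : ι → Fin N, |g (fun i => Real.cos (2 * π * (a i : ℕ) / N)) * ∏ i, W i (a i) -
          g (fun i => Real.cos (t i)) * ∏ i, W i (a i)| := abs_sum_le_sum_abs _ _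
    _ ≤ ∑ a : ι → Fin N, (K * ∑ i, |Real.cos (2 * π * (a i : ℕ) / N) - Real.cos (t i)|) * ∏ i, W i (a i) :=
        Finset.sum_le_sum fun a _ => by
          rw [← sub_mul, abs_mul, abs_of_nonneg (hnn a)]
          exact mul_le_mul_of_nonneg_right (hK _ _ (hnode a) hy) (hnn a)
    _ = K * ∑ i, ∑ a : ι → Fin N, |Real.cos (t i) - Real.cos (2 * π * (a i : ℕ) / N)| * ∏ j, W j (a j) := by
        rw [Finset.sum_comm, Finset.mul_sum]
        refine Finset.sum_congr rfl fun a _ => ?_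
        rw [Finset.mul_sum, Finset.mul_sum, Finset.sum_mul]
        exact Finset.sum_congr rfl fun i _ => by rw [abs_sub_comm]; ring
    _ ≤ K * ∑ _i : ι, π / m :=
        mul_le_mul_of_nonneg_left (Finset.sum_le_sum fun i _ => sum_abs_sub_mul_prod_jacksonWeight_le hm hN t i) hK0
    _ = K * (π * Fintype.card ι / m) := by
        rw [Finset.sum_const, Finset.card_univ, nsmul_eq_mul]; ring

/-- ★ **… ON THE CUBE**: for `x ∈ [−1,1]^ι` take `t_i = arccos x_i` (`cos(arccos x_i) = x_i`):
`|Σ_a g((cos(2πa_i∕N))_i)·∏_i W_{a_i}(arccos x_i) − g(x)| ≤ K·π·|ι|∕m`. [folklore] -/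
theorem abs_tensorJackson_sub_le_cube {g : (ι → ℝ) → ℝ} {K : ℝ} (hK0 : 0 ≤ K)
    (hK : ∀ u v : ι → ℝ, (∀ i, u i ∈ Set.Icc (-1 : ℝ) 1) → (∀ i, v i ∈ Set.Icc (-1 : ℝ) 1) → |g u - g v| ≤ K * ∑ i, |u i - v i|)
    {m N : ℕ} (hm : 0 < m) (hN : 2 * m ≤ N) {x : ι → ℝ} (hx : ∀ i, x i ∈ Set.Icc (-1 : ℝ) 1) :
    |∑ a : ι → Fin N, g (fun i => Real.cos (2 * π * (a i : ℕ) / N)) * ∏ i,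
        ((∑ j₁ ∈ range m, ∑ j₂ ∈ range m, Real.cos (((j₁ : ℝ) - j₂) * (Real.arccos (x i) - 2 * π * (a i : ℕ) / N))) ^ 2 +
            (∑ j₁ ∈ range m, ∑ j₂ ∈ range m, Real.cos (((j₁ : ℝ) - j₂) * (Real.arccos (x i) + 2 * π * (a i : ℕ) / N))) ^ 2) /
          (2 * N * (m * (2 * m ^ 2 + 1) / 3)) -
      g x| ≤ K * (π * Fintype.card ι / m) := by
  have h := abs_tensorJackson_sub_le hK0 hK hm hN (fun i => Real.arccos (x i))
  have hx' : (fun i => Real.cos (Real.arccos (x i))) = x := funext fun i => Real.cos_arccos (hx i).1 (hx i).2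
  rwa [hx'] at h

end Summit.QuantumFields.YangMills.Theorems.BalabanUVNodesN19DiscreteJacksonTensor

end
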